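/-
Copyright (c) 2026 the pub-hodgecm-mathlib formalisation cell (harness21).  Prover seat hodgecm-mathlib-K2E1-p10 (g3), Track B ∕ K2-LIT (build stream 29), h413 = `stmt-HodgeConjecture-24833`,
route of record `HCCMUnconditional`, AMENDMENT #3 «GENERAL (U,τ) LADDER» rung C.1, C7_τ FILE 2 (F2b_τ); dealer K2E1-plan (g7) deal (269): the `τ`-TWISTED twin of ★ F2b
`K2E1PseudoEisensteinKAverageU2` — the twisted `K`-average of a square-integrable pseudo-Eisenstein series and the head «`E ∩ L²(X)^{τ}` is the closed span of the
`τ`-EQUIVARIANT square-integrable pseudo-Eisenstein series» (generic, and the `U(Φ₂)` print), over ★ F1_τ `K2E1KTypeAverageProjectionU` (K2E4-p14).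
-/
import Summits.HodgeConjecture.HodgeConjecture.Theorems.K2E1PseudoEisensteinKAverageU2     -- ★ F2b p859977-series (this lineage): §1 Urysohn `η ≡ 1` on `ι(K)`; brings ★ F2a (majorants), ★ f1 (density at `U(Φ₂)`)
import Summits.HodgeConjecture.HodgeConjecture.Theorems.K2E1KTypeAverageProjectionU        -- ★ F1_τ p860830 (K2E4-p14): `E ⊓ H^{τ} = closure span (P_τ '' S)`
import HarnessLib

/-!
# h413 ∕ Track B «K2-LIT», AMENDMENT #3 C.1, C7_τ FILE 2 — helper `K2E1PseudoEisensteinKTypeAverageU2`: THE TWISTED `K`-AVERAGE `P_τ[θ_Φ] = [θ_{Φ^{♮,τ}}]`,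
# `Φ^{♮,τ}(h) = ∫_K τ(k) Φ(ι(k)h) dk`, AND THE HEAD `Wᗮ ∩ L²(X)^{τ} = closure span {[θ_Ψ] : Ψ ∈ 𝒯_i, Ψ(ι(k)h) = τ(k)⁻¹ Ψ(h)}` — generic over ★ `AdelicGroupData`, printed for `U(Φ₂)`

Cell `pub/hodgecm-mathlib`, crux h413 = `stmt-HodgeConjecture-24833`, route `HCCMUnconditional`; dealer K2E1-plan (g7) (269), AMENDMENT #3 rung C.1 (ROADCARD §2 C7 (a) at an arbitrary `K`-type).
THEOREMS ONLY (no `def`, no `instance`, no notation, no named-fact hypothesis, no `sorry`); lane `--supports stmt-HodgeConjecture-24833 --as helper` (count-neutral); closes no socket.  It is ★ F2b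
(`τ = 1`) with a unitary character `τ : K →* ℂ`, `‖τ‖ = 1`, of the compact group `K` inserted, in the currency of the engine ★ F1_τ: the twisted average `P_τ v = ∫_K τ(k)⁻¹ • R(ι k) v dμK`
and the `τ`-isotypic subspace `L²(X)^{τ} = ⨅_k eigenspace(R(ι k), τ k)`; §0 bundles the bare multiplicative unitary `ω : K → ℂ` of ★ `chiSectionSpace χ K' ω` (K2E1-p12's currency) into such a `τ`.
CONVENTIONS (★ (H2)-d): `X = G(𝔸) ⧸ A_G G(K)`, `(R(g)f)(x) = f(g⁻¹ • x)`, `θ_Φ(x) = Σ'_q Φ(x̃ q̃)` for `Φ` in the square-integrable test class `𝒯_i` (Borel, right-`N_i(𝔸)`-invariant, `∫⁻ θ_{‖Φ‖}² dμ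
< ∞`), `R(g)[θ_Φ] = [θ_{Φ(g⁻¹ ·)}]`.  Hence `[θ_Ψ]` is a `τ`-VECTOR (`R(ι k)[θ_Ψ] = τ(k)[θ_Ψ]`) exactly when `Ψ(ι(k) h) = τ(k)⁻¹ Ψ(h)` (§4) — THE SIGN OF THE TWIST; the twisted average
producing such `Ψ` is `Φ^{♮,τ}(h) = ∫_K τ(k) Φ(ι(k) h) dμK = ∫_K τ(k)⁻¹ Φ(ι(k)⁻¹ h) dμK` (§2).
THE MATHEMATICS, AND WHY ★ F2b's ROAD DOES NOT TRANSFER.  ★ F2b got `P_K[θ_Φ] = [θ_{Φ^♮}]` from ★ F2a (`R(η)[θ_Φ] = [θ_{Φ^η}]`, `η ∈ C_c(G(𝔸))`) with `ν = ι_*μK` and a Urysohn `η ≡ 1` on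
`ι(K)`; the twist `τ(k)⁻¹` lives on `K`, not on `G(𝔸)` — no test function on `G(𝔸)` restricts to it along a non-injective `ι`.  Instead (§1) the Literature lemma ★ `coeFn_integral_smul_domSMul_ae_eq`
(«the `L²`-valued Bochner integral of weighted translates is the orbital smoothing») is applied to the COMPACT GROUP `K` ACTING ON `X` THROUGH `ι` (a proof-local `MulAction.compHom`, invariance
and measurability transported along `ι`; a continuous weight on `K` is compactly supported): `∫_K w(k) • R(ι k) f dμK` has the representative `x ↦ ∫_K w(k) f(ι(k)⁻¹ • x) dμK`.  §3 runs ★ F2a's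
pointwise road along `K`: at `μ`-a.e. `x` the counting majorant `Σ_q ∫_K |Φ(ι(k)⁻¹ x̃ q̃)| dμK` is finite (★ F2a `ae_tsum_lintegral_lt_top` at `(ι_*μK, η)` + `lintegral_map`), so
`∫_K τ(k)⁻¹ θ_Φ(ι(k)⁻¹ • x) dμK = Σ_q ∫_K τ(k)⁻¹ Φ(ι(k)⁻¹ x̃ q̃) dμK = θ_{Φ^{♮,τ}}(x)` (★ (H2)-d pointwise, Mathlib `integral_tsum`); and `Φ^{♮,τ} ∈ 𝒯_i` by DOMINATION `|Φ^{♮,τ}(h)| ≤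
∫_K |Φ(ι(k)⁻¹ h)| dμK = (|Φ|)^{η}(h)`, the ★ F2a smoothing of `|Φ| ∈ 𝒯_i` by `(ι_*μK, η)`.  §4–§5 are ★ F2b §4–§5 VERBATIM over ★ F1_τ `inf_iInf_eigenspace_eq_topologicalClosure_span_image_tauAverage`.
§0 `exists_monoidHom_coe_eq` (bare `ω` ⟹ bundled `τ`) · §1 `integral_mul_comp_congr_ae`, **`coeFn_integral_smul_rightRegular_ae_eq`** (representative of `∫_K w(k) • R(ι k) f dμK`) · §2 `measurable_tauAverage`,
`tauAverage_mul_radical`, `tauAverage_eq_integral_inv`, **`tauAverage_mul_left`**, `norm_tauAverage_le_integral_norm` · §3 `ae_tsum_lintegral_comp_lt_top`, `integral_mul_tsum_eq_tsum`,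
`lintegral_tsum_enorm_tauAverage_sq_lt_top`, **`integral_smul_rightRegular_toLp_pseudoEisenstein_eq`** (`P_τ[θ_Φ] = [θ_{Φ^{♮,τ}}]`) · §4 `toLp_pseudoEisenstein_mem_iInf_eigenspace_of_forall`,
**`orthogonal_inf_iInf_eigenspace_eq_topologicalClosure_span`** (generic head) · §5 **`cmCuspidalSubspace_orthogonal_inf_iInf_eigenspace_eq_topologicalClosure_span_two`** (`U(Φ₂)`, letter-free over ★ f1).

HONEST LABEL: HC_CM is proved only modulo the 7 printed citations (2 remaining named inputs: hLiu418 = `stmt-HodgeConjecture-24832`, h413 = `stmt-HodgeConjecture-24833`) until rung 0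
closes; this file asserts no named fact and closes no socket.
References: [MoeglinWaldspurger1995] Mœglin–Waldspurger, *Spectral Decomposition and Eisenstein Series*, II.1.1–II.1.4, II.1.12; [BorelJacquet1979] Borel–Jacquet, PSPM 33.1, §4.6; [DeitmarEchterhoff2014]
Deitmar–Echterhoff, *Principles of Harmonic Analysis* (2nd ed.), Lemma 7.2.6, Prop. 6.2.1, Lemma 9.2.6; [Knapp1986] Knapp, *Representation Theory of Semisimple Groups*, VIII §3; [Folland1999] Folland, *Real Analysis*, Thm. 2.37.
-/

set_option autoImplicit false
set_option linter.dupNamespace false  -- the mandated namespace repeats the summit's segment (`HodgeConjecture.HodgeConjecture`)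

noncomputable section

open MeasureTheory Measure Set Filter Topology CompactlySupported NumberField
open Literature.MeasureTheory.Group Literature.NumberTheory.Automorphic Literature.NumberTheory.Automorphic.UnitaryGroup ContRepresentation
open Summit.HodgeConjecture.HodgeConjecture.Cruxes.H413.K2E1PseudoEisensteinCuspOrthogonal (memLp_two_pseudoEisenstein_automorphicQuotient)
open Summit.HodgeConjecture.HodgeConjecture.Cruxes.H413.K2E1PseudoEisensteinDensity (rightRegular_inv_apply_toLp_pseudoEisenstein translate_mul_radical lintegral_tsum_enorm_translate_sq_eq tsum_quotient_out_smul_eq)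
open Summit.HodgeConjecture.HodgeConjecture.Cruxes.H413.K2E1PseudoEisensteinSmoothingU
open Summit.HodgeConjecture.HodgeConjecture.Cruxes.H413.K2E1PseudoEisensteinKAverageU2 (exists_compactlySupported_apply_eq_one)
open Summit.HodgeConjecture.HodgeConjecture.Cruxes.H413.K2E1KTypeAverageProjectionU
open Summit.HodgeConjecture.HodgeConjecture.Cruxes.H413.K2E1CuspidalSpectrumUnitary
open Summit.HodgeConjecture.HodgeConjecture.Cruxes.H413.K2E1PseudoEisensteinDensityU (cmCuspidalSubspace_orthogonal_eq_topologicalClosure_span_two)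
open scoped ENNReal NNReal Pointwise InnerProductSpace ComplexConjugate

namespace Summit.HodgeConjecture.HodgeConjecture.Cruxes.H413.K2E1PseudoEisensteinKTypeAverageU2

universe u

/-- §0 **BUNDLING A `K`-TYPE CHARACTER**: a multiplicative `ω : K → ℂ` of modulus one (the currency of ★ `chiSectionSpace χ K' ω`) is a monoid homomorphism (`ω(1) = ω(1)²`, `ω(1) ≠ 0`
force `ω(1) = 1`), so the bundled-`τ` statements below apply to it with `⇑τ = ω`. [cite: Knapp1986, VIII §3] -/
theorem exists_monoidHom_coe_eq {Kc : Type*} [Group Kc] {ω : Kc → ℂ} (hωmul : ∀ k k' : Kc, ω (k * k') = ω k * ω k') (hω1 : ∀ k : Kc, ‖ω k‖ = 1) : ∃ τ : Kc →* ℂ, ⇑τ = ω := by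
  have h0 : ω 1 ≠ 0 := norm_ne_zero_iff.1 (by rw [hω1 1]; exact one_ne_zero)
  have h1 : ω 1 * ω 1 = ω 1 * 1 := by rw [mul_one, ← hωmul, one_mul]
  exact ⟨⟨⟨ω, mul_left_cancel₀ h0 h1⟩, hωmul⟩, rfl⟩

/-! ## §1 The `L²`-class `∫_K w(k) • R(ι k) f dμK` has the representative `x ↦ ∫_K w(k) f(ι(k)⁻¹ • x) dμK` (the compact group acting through `ι`) -/

section Representative

variable {K : Type} [Field K] [NumberField K] (𝒢 : AdelicGroupData.{u} K)
  [MeasurableSpace 𝒢.Adelic] [BorelSpace 𝒢.Adelic] [SecondCountableTopology 𝒢.Adelic]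
  (μ : Measure 𝒢.automorphicQuotient) [𝒢.IsAutomorphicMeasure μ]
  {Kc : Type*} [Group Kc] [TopologicalSpace Kc] [IsTopologicalGroup Kc] [MeasurableSpace Kc] [BorelSpace Kc]
  (μK : Measure Kc) [IsFiniteMeasure μK] {ι : Kc →* 𝒢.Adelic}

/-- **TWISTED `K`-AVERAGES OF A.E.-EQUAL FUNCTIONS AGREE A.E.**: `f = f'` `μ`-a.e. ⟹ `∫_K w(k) f(ι(k)⁻¹ • x) dμK = ∫_K w(k) f'(ι(k)⁻¹ • x) dμK` for `μ`-a.e. `x` (the bad set pulls back to a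
`μ ⊗ μK`-null set along the quasi-measure-preserving `(x, k) ↦ ι(k)⁻¹ • x`, ★ `quasiMeasurePreserving_inv_smul_prod` for `K` acting on `X` through `ι`). [cite: Folland1999, Thm. 2.37] -/
theorem integral_mul_comp_congr_ae (hι : Measurable ι) {f f' : 𝒢.automorphicQuotient → ℂ} (hff' : f =ᵐ[μ] f') (w : Kc → ℂ) :
    (fun x : 𝒢.automorphicQuotient => ∫ k, w k * f ((ι k)⁻¹ • x) ∂μK) =ᵐ[μ] fun x : 𝒢.automorphicQuotient => ∫ k, w k * f' ((ι k)⁻¹ • x) ∂μK := by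
  haveI : MeasurableSMul₂ 𝒢.Adelic 𝒢.automorphicQuotient := inferInstance
  letI : MulAction Kc 𝒢.automorphicQuotient := MulAction.compHom 𝒢.automorphicQuotient ι
  haveI : MeasurableSMul₂ Kc 𝒢.automorphicQuotient := ⟨(hι.comp measurable_fst).smul measurable_snd⟩
  haveI : SMulInvariantMeasure Kc 𝒢.automorphicQuotient μ := ⟨fun k s hs => SMulInvariantMeasure.measure_preimage_smul (ι k) hs⟩
  have hN : ∀ᵐ p ∂(μ.prod μK), f (p.2⁻¹ • p.1) = f' (p.2⁻¹ • p.1) := (quasiMeasurePreserving_inv_smul_prod μ μK).ae_eq hff'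
  filter_upwards [Measure.ae_ae_of_ae_prod hN] with x hx
  refine integral_congr_ae (hx.mono fun k hk => ?_)
  show w k * f ((ι k)⁻¹ • x) = w k * f' ((ι k)⁻¹ • x)
  rw [← map_inv, show f (ι k⁻¹ • x) = f' (ι k⁻¹ • x) from hk]

variable [SecondCountableTopology Kc]

/-- **THE REPRESENTATIVE OF A WEIGHTED `K`-AVERAGE OF TRANSLATES**: for the regular representation `R` of `G(𝔸)` on `L²(X, μ)`, a second countable group `K` with a finite measure `μK`, a
continuous `ι : K →* G(𝔸)` and a continuous compactly supported weight `w : K → ℂ`, the `L²`-valued Bochner integral `∫_K w(k) • R(ι k) f dμK` has the representative `x ↦ ∫_K w(k) f(ι(k)⁻¹ • x) dμK`: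
★ `coeFn_integral_smul_domSMul_ae_eq` for `K` acting on `X` THROUGH `ι` (`k • x := ι(k) • x`; `R(ι k) f = k · f` in Mathlib's domain action). [cite: BorelJacquet1979, §4.6] [cite: DeitmarEchterhoff2014, Lemma 9.2.6] -/
theorem coeFn_integral_smul_rightRegular_ae_eq (hι : Continuous ι) {w : Kc → ℂ} (hw : Continuous w) (hws : HasCompactSupport w) (f : 𝒢.L2 μ) :
    ((∫ k, w k • 𝒢.rightRegular μ (ι k) f ∂μK : 𝒢.L2 μ) : 𝒢.automorphicQuotient → ℂ) =ᵐ[μ]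
      fun x : 𝒢.automorphicQuotient => ∫ k, w k * (f : 𝒢.automorphicQuotient → ℂ) ((ι k)⁻¹ • x) ∂μK := by
  haveI : MeasurableSMul₂ 𝒢.Adelic 𝒢.automorphicQuotient := inferInstance
  letI : MulAction Kc 𝒢.automorphicQuotient := MulAction.compHom 𝒢.automorphicQuotient ι
  haveI : MeasurableSMul₂ Kc 𝒢.automorphicQuotient := ⟨(hι.measurable.comp measurable_fst).smul measurable_snd⟩
  haveI : SMulInvariantMeasure Kc 𝒢.automorphicQuotient μ := ⟨fun k s hs => SMulInvariantMeasure.measure_preimage_smul (ι k) hs⟩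
  have hR : ∀ k : Kc, (DomMulAct.mk k⁻¹ • f : 𝒢.L2 μ) = 𝒢.rightRegular μ (ι k) f := fun k => by
    refine Lp.ext ((DomMulAct.smul_Lp_ae_eq (DomMulAct.mk k⁻¹) f).trans ((𝒢.rightRegular_apply_coeFn μ (ι k) f).trans (Eventually.of_forall fun x => ?_)).symm)
    show (f : 𝒢.automorphicQuotient → ℂ) ((ι k)⁻¹ • x) = (f : 𝒢.automorphicQuotient → ℂ) (ι k⁻¹ • x)
    rw [map_inv]
  have hF : AEStronglyMeasurable (fun k : Kc => (DomMulAct.mk k⁻¹ • f : 𝒢.L2 μ)) μK := by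
    rw [show (fun k : Kc => (DomMulAct.mk k⁻¹ • f : 𝒢.L2 μ)) = fun k : Kc => 𝒢.rightRegular μ (ι k) f from funext hR]
    exact (((𝒢.isStronglyContinuous_rightRegular_holds μ) f).comp hι).aestronglyMeasurable
  have hA := coeFn_integral_smul_domSMul_ae_eq μ μK hw hws f hF
  rw [show (∫ k, w k • (DomMulAct.mk k⁻¹ • f : 𝒢.L2 μ) ∂μK) = ∫ k, w k • 𝒢.rightRegular μ (ι k) f ∂μK from integral_congr_ae (Eventually.of_forall fun k => by simp only [hR k])] at hA
  refine hA.trans (Eventually.of_forall fun x => ?_)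
  simp only [orbitalSmoothing, smul_eq_mul]
  refine integral_congr_ae (Eventually.of_forall fun k => ?_)
  show w k * (f : 𝒢.automorphicQuotient → ℂ) (ι k⁻¹ • x) = w k * (f : 𝒢.automorphicQuotient → ℂ) ((ι k)⁻¹ • x)
  rw [map_inv]

end Representative

/-! ## §2 The twisted average `Φ^{♮,τ}(h) = ∫_K τ(k) Φ(ι(k) h) dμK`: Borel, right-`N_i(𝔸)`-invariant, `τ`-equivariant, dominated by the plain average of `|Φ|` -/

section TwistedAverage

variable {K : Type} [Field K] [NumberField K] (𝒢 : AdelicGroupData.{u} K)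
  [MeasurableSpace 𝒢.Adelic] [BorelSpace 𝒢.Adelic] [SecondCountableTopology 𝒢.Adelic]
  (𝔓 : 𝒢.ParabolicUnipotentData) (i : 𝔓.ι)
  {Kc : Type*} [Group Kc] [MeasurableSpace Kc] (μK : Measure Kc) (ι : Kc →* 𝒢.Adelic) (τ : Kc →* ℂ)

/-- `Φ^{♮,τ} : h ↦ ∫_K τ(k) Φ(ι(k) h) dμK` is Borel for Borel `Φ`, `τ`, `ι` (a parametric integral of a jointly Borel integrand; `μK` s-finite). [cite: Folland1999, Thm. 2.37] -/
theorem measurable_tauAverage [SFinite μK] (hι : Measurable ι) (hτm : Measurable τ) {Φ : 𝒢.Adelic → ℂ} (hΦm : Measurable Φ) :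
    Measurable fun h : 𝒢.Adelic => ∫ k, τ k * Φ (ι k * h) ∂μK := by
  have hF : Measurable (Function.uncurry fun (h : 𝒢.Adelic) (k : Kc) => τ k * Φ (ι k * h)) :=
    (hτm.comp measurable_snd).mul (hΦm.comp ((hι.comp measurable_snd).mul measurable_fst))
  exact (hF.stronglyMeasurable.integral_prod_right' (ν := μK)).measurable

omit [MeasurableSpace 𝒢.Adelic] [BorelSpace 𝒢.Adelic] [SecondCountableTopology 𝒢.Adelic] in
/-- `Φ^{♮,τ}` is right-`N_i(𝔸)`-invariant when `Φ` is. [cite: MoeglinWaldspurger1995, II.1.1] -/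
theorem tauAverage_mul_radical {Φ : 𝒢.Adelic → ℂ} (hΦ : ∀ (g : 𝒢.Adelic) (n : 𝔓.radical i), Φ (g * n) = Φ g) :
    ∀ (h : 𝒢.Adelic) (n : 𝔓.radical i), (fun h : 𝒢.Adelic => ∫ k, τ k * Φ (ι k * h) ∂μK) (h * n) = (fun h : 𝒢.Adelic => ∫ k, τ k * Φ (ι k * h) ∂μK) h := fun h n => by
  simp only [← mul_assoc, hΦ]

omit [MeasurableSpace 𝒢.Adelic] [BorelSpace 𝒢.Adelic] [SecondCountableTopology 𝒢.Adelic] in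
/-- **THE TWO FORMS OF THE TWISTED AVERAGE**: `∫_K τ(k) Φ(ι(k) h) dμK = ∫_K τ(k)⁻¹ Φ(ι(k)⁻¹ h) dμK` (inversion invariance of `μK`; `τ(k⁻¹) = τ(k)⁻¹`). [cite: Folland1999, Thm. 2.37] -/
theorem tauAverage_eq_integral_inv [MeasurableInv Kc] [μK.IsInvInvariant] (Φ : 𝒢.Adelic → ℂ) (h : 𝒢.Adelic) :
    (fun h : 𝒢.Adelic => ∫ k, τ k * Φ (ι k * h) ∂μK) h = ∫ k, (τ k)⁻¹ * Φ ((ι k)⁻¹ * h) ∂μK := by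
  show ∫ k, τ k * Φ (ι k * h) ∂μK = ∫ k, (τ k)⁻¹ * Φ ((ι k)⁻¹ * h) ∂μK
  rw [← integral_inv_eq_self (fun k : Kc => (τ k)⁻¹ * Φ ((ι k)⁻¹ * h)) μK]
  exact integral_congr_ae (Eventually.of_forall fun k => by simp only [map_inv, inv_inv])

omit [MeasurableSpace 𝒢.Adelic] [BorelSpace 𝒢.Adelic] [SecondCountableTopology 𝒢.Adelic] in
/-- **`Φ^{♮,τ}` IS `τ`-EQUIVARIANT**: `Φ^{♮,τ}(ι(k₀) h) = ∫_K τ(k) Φ(ι(k k₀) h) dμK = τ(k₀)⁻¹ ∫_K τ(k k₀) Φ(ι(k k₀) h) dμK = τ(k₀)⁻¹ Φ^{♮,τ}(h)` (right invariance of `μK`, `τ(k₀) ≠ 0`) — the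
equivariance under which `[θ_{Φ^{♮,τ}}]` is a `τ`-vector (§4). [cite: DeitmarEchterhoff2014, Lemma 7.2.6] [cite: Knapp1986, VIII §3] -/
theorem tauAverage_mul_left [MeasurableMul Kc] [μK.IsMulRightInvariant] (hτ : ∀ k, ‖τ k‖ = 1) (Φ : 𝒢.Adelic → ℂ) (k₀ : Kc) (h : 𝒢.Adelic) :
    (fun h : 𝒢.Adelic => ∫ k, τ k * Φ (ι k * h) ∂μK) (ι k₀ * h) = (τ k₀)⁻¹ * (fun h : 𝒢.Adelic => ∫ k, τ k * Φ (ι k * h) ∂μK) h := by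
  show ∫ k, τ k * Φ (ι k * (ι k₀ * h)) ∂μK = (τ k₀)⁻¹ * ∫ k, τ k * Φ (ι k * h) ∂μK
  have h0 : τ k₀ ≠ 0 := ne_zero_of_norm_eq_one τ hτ k₀
  have h1 : (fun k : Kc => τ k * Φ (ι k * (ι k₀ * h))) = fun k : Kc => (τ k₀)⁻¹ * (τ (k * k₀) * Φ (ι (k * k₀) * h)) := funext fun k => by
    rw [map_mul, map_mul, mul_assoc (ι k) (ι k₀) h, mul_comm (τ k) (τ k₀), mul_assoc (τ k₀) (τ k), ← mul_assoc (τ k₀)⁻¹, inv_mul_cancel₀ h0, one_mul]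
  rw [h1, integral_const_mul]
  congr 1
  exact integral_mul_right_eq_self (fun k' : Kc => τ k' * Φ (ι k' * h)) k₀

omit [MeasurableSpace 𝒢.Adelic] [BorelSpace 𝒢.Adelic] [SecondCountableTopology 𝒢.Adelic] in
/-- **DOMINATION BY THE PLAIN AVERAGE OF `|Φ|`**: `‖Φ^{♮,τ}(h)‖ ≤ ∫_K ‖Φ(ι(k)⁻¹ h)‖ dμK` (`‖∫ F‖ ≤ ∫ ‖F‖`, `|τ| = 1`, inversion invariance). [cite: DeitmarEchterhoff2014, Prop. 6.2.1] -/
theorem norm_tauAverage_le_integral_norm [MeasurableInv Kc] [μK.IsInvInvariant] (hτ : ∀ k, ‖τ k‖ = 1) (Φ : 𝒢.Adelic → ℂ) (h : 𝒢.Adelic) :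
    ‖(fun h : 𝒢.Adelic => ∫ k, τ k * Φ (ι k * h) ∂μK) h‖ ≤ ∫ k, ‖Φ ((ι k)⁻¹ * h)‖ ∂μK := by
  rw [tauAverage_eq_integral_inv 𝒢 μK ι τ Φ h]
  refine (norm_integral_le_integral_norm _).trans (le_of_eq (integral_congr_ae (Eventually.of_forall fun k => ?_)))
  show ‖(τ k)⁻¹ * Φ ((ι k)⁻¹ * h)‖ = ‖Φ ((ι k)⁻¹ * h)‖
  rw [norm_mul, norm_inv, hτ k, inv_one, one_mul]

end TwistedAverage

/-! ## §3 `P_τ[θ_Φ] = [θ_{Φ^{♮,τ}}]`: the pointwise road along `K` and the square-integrability of the twisted average -/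

section Engine

variable {K : Type} [Field K] [NumberField K] (𝒢 : AdelicGroupData.{u} K)
  [MeasurableSpace 𝒢.Adelic] [BorelSpace 𝒢.Adelic] [LocallyCompactSpace 𝒢.Adelic] [SecondCountableTopology 𝒢.Adelic] [T2Space 𝒢.Adelic]
  [DiscreteTopology 𝒢.quotientSubgroup] (𝔓 : 𝒢.ParabolicUnipotentData) (i : 𝔓.ι)
  (μ : Measure 𝒢.automorphicQuotient) [𝒢.IsAutomorphicMeasure μ]
  {Kc : Type*} [Group Kc] [TopologicalSpace Kc] [IsTopologicalGroup Kc] [CompactSpace Kc] [SecondCountableTopology Kc] [MeasurableSpace Kc] [BorelSpace Kc]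
  (μK : Measure Kc) [IsProbabilityMeasure μK] (ι : Kc →* 𝒢.Adelic) (τ : Kc →* ℂ)

omit [TopologicalSpace Kc] [IsTopologicalGroup Kc] [CompactSpace Kc] [SecondCountableTopology Kc] [BorelSpace Kc] [IsProbabilityMeasure μK] in
/-- **A.E. FINITENESS OF THE COUNTING MAJORANT ALONG `K`**: for `Φ ∈ 𝒯_i`, at `μ`-a.e. `x`, `Σ'_q ∫⁻_K ‖Φ(ι(k)⁻¹ x̃ q̃)‖ dμK < ∞` — ★ F2a `ae_tsum_lintegral_lt_top` for the
push-forward `ι_*μK` and any `η ∈ C_c(G(𝔸))` with `η ≡ 1` on `ι(K)`, read back on `K` by `lintegral_map`. [cite: Folland1999, Thm. 2.37] [cite: MoeglinWaldspurger1995, II.1.2] -/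
theorem ae_tsum_lintegral_comp_lt_top [IsFiniteMeasure μK] (hι : Measurable ι) {η : C_c(𝒢.Adelic, ℂ)} (hη : ∀ k : Kc, η (ι k) = 1) {Φ : 𝒢.Adelic → ℂ} (hΦm : Measurable Φ)
    (hΦ : ∀ (g : 𝒢.Adelic) (n : 𝔓.radical i), Φ (g * n) = Φ g)
    (h2 : ∫⁻ x, (∑' q : 𝒢.quotientSubgroup ⧸ (𝔓.radical i).subgroupOf 𝒢.quotientSubgroup, ‖Φ ((Quotient.out x : 𝒢.Adelic) * ((q.out : 𝒢.quotientSubgroup) : 𝒢.Adelic))‖ₑ) ^ 2 ∂μ < ∞) :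
    ∀ᵐ x ∂μ, (∑' q : 𝒢.quotientSubgroup ⧸ (𝔓.radical i).subgroupOf 𝒢.quotientSubgroup, ∫⁻ k, ‖Φ ((ι k)⁻¹ * ((Quotient.out x : 𝒢.Adelic) * ((q.out : 𝒢.quotientSubgroup) : 𝒢.Adelic)))‖ₑ ∂μK) < ∞ := by
  have hconv : ∀ y : 𝒢.Adelic, ∫⁻ g, ‖η g * Φ (g⁻¹ * y)‖ₑ ∂(μK.map ι) = ∫⁻ k, ‖Φ ((ι k)⁻¹ * y)‖ₑ ∂μK := fun y => by
    have hmeas : Measurable fun g : 𝒢.Adelic => ‖η g * Φ (g⁻¹ * y)‖ₑ := (η.continuous.measurable.mul (hΦm.comp (measurable_inv.mul_const y))).enorm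
    rw [lintegral_map hmeas hι]
    exact lintegral_congr fun k => by rw [hη k, one_mul]
  filter_upwards [ae_tsum_lintegral_lt_top 𝒢 𝔓 i μ (μK.map ι) η hΦm hΦ h2] with x hx
  simpa only [hconv] using hx

omit [LocallyCompactSpace 𝒢.Adelic] [T2Space 𝒢.Adelic] [TopologicalSpace Kc] [IsTopologicalGroup Kc] [CompactSpace Kc] [SecondCountableTopology Kc] [BorelSpace Kc]
  [IsProbabilityMeasure μK] in
/-- **THE POINTWISE IDENTITY ALONG `K`**: where the counting majorant is finite, `∫_K τ(k)⁻¹ θ_Φ(ι(k)⁻¹ • x) dμK = Σ'_q ∫_K τ(k)⁻¹ Φ(ι(k)⁻¹ x̃ q̃) dμK` (★ (H2)-d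
`tsum_quotient_out_smul_eq` pointwise, then Mathlib `integral_tsum`; `|τ⁻¹| = 1`). [cite: MoeglinWaldspurger1995, II.1.1] [cite: BorelJacquet1979, §4.6] -/
theorem integral_mul_tsum_eq_tsum (hι : Measurable ι) (hτm : Measurable τ) (hτ : ∀ k, ‖τ k‖ = 1) {Φ : 𝒢.Adelic → ℂ} (hΦm : Measurable Φ)
    (hΦ : ∀ (g : 𝒢.Adelic) (n : 𝔓.radical i), Φ (g * n) = Φ g) {x : 𝒢.automorphicQuotient}
    (hx : (∑' q : 𝒢.quotientSubgroup ⧸ (𝔓.radical i).subgroupOf 𝒢.quotientSubgroup, ∫⁻ k, ‖Φ ((ι k)⁻¹ * ((Quotient.out x : 𝒢.Adelic) * ((q.out : 𝒢.quotientSubgroup) : 𝒢.Adelic)))‖ₑ ∂μK) < ∞) :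
    ∫ k, (τ k)⁻¹ * (fun y : 𝒢.automorphicQuotient => ∑' q : 𝒢.quotientSubgroup ⧸ (𝔓.radical i).subgroupOf 𝒢.quotientSubgroup, Φ ((Quotient.out y : 𝒢.Adelic) * ((q.out : 𝒢.quotientSubgroup) : 𝒢.Adelic))) ((ι k)⁻¹ • x) ∂μK =
      ∑' q : 𝒢.quotientSubgroup ⧸ (𝔓.radical i).subgroupOf 𝒢.quotientSubgroup, ∫ k, (τ k)⁻¹ * Φ ((ι k)⁻¹ * ((Quotient.out x : 𝒢.Adelic) * ((q.out : 𝒢.quotientSubgroup) : 𝒢.Adelic))) ∂μK := by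
  haveI : Countable (𝒢.quotientSubgroup ⧸ (𝔓.radical i).subgroupOf 𝒢.quotientSubgroup) := by
    haveI : SecondCountableTopology 𝒢.quotientSubgroup := TopologicalSpace.Subtype.secondCountableTopology _
    haveI : Countable 𝒢.quotientSubgroup := countable_of_Lindelof_of_discrete
    exact (QuotientGroup.mk_surjective (s := (𝔓.radical i).subgroupOf 𝒢.quotientSubgroup)).countable
  have hτe : ∀ k : Kc, ‖(τ k)⁻¹‖ₑ = 1 := fun k => by rw [← ofReal_norm, norm_inv, hτ k, inv_one, ENNReal.ofReal_one]
  have hpt : ∀ k : Kc, (τ k)⁻¹ * (∑' q : 𝒢.quotientSubgroup ⧸ (𝔓.radical i).subgroupOf 𝒢.quotientSubgroup,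
      Φ ((Quotient.out ((ι k)⁻¹ • x) : 𝒢.Adelic) * ((q.out : 𝒢.quotientSubgroup) : 𝒢.Adelic))) =
        ∑' q : 𝒢.quotientSubgroup ⧸ (𝔓.radical i).subgroupOf 𝒢.quotientSubgroup, (τ k)⁻¹ * Φ ((ι k)⁻¹ * ((Quotient.out x : 𝒢.Adelic) * ((q.out : 𝒢.quotientSubgroup) : 𝒢.Adelic))) :=
    fun k => by rw [tsum_quotient_out_smul_eq 𝒢 𝔓 i hΦ (ι k)⁻¹ x, ← tsum_mul_left]
  simp_rw [hpt]
  refine integral_tsum (fun q => (((hτm.inv).mul (hΦm.comp ((hι.inv).mul_const _)))).aestronglyMeasurable) (ne_of_lt (lt_of_le_of_lt (le_of_eq ?_) hx))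
  exact tsum_congr fun q => lintegral_congr fun k => by rw [enorm_mul, hτe k, one_mul]

omit [TopologicalSpace Kc] [IsTopologicalGroup Kc] [CompactSpace Kc] [SecondCountableTopology Kc] [BorelSpace Kc] [IsProbabilityMeasure μK] in
/-- **`Φ^{♮,τ} ∈ 𝒯_i`**: `∫⁻_X θ_{‖Φ^{♮,τ}‖}² dμ < ∞` by DOMINATION: `‖Φ^{♮,τ}(h)‖ ≤ ∫_K ‖Φ(ι(k)⁻¹ h)‖ dμK = ‖(|Φ|)^{η}(h)‖` (§2), `(|Φ|)^{η}(h) = ∫ η(g) |Φ|(g⁻¹ h) d(ι_*μK)(g)` the ★ F2a smoothing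
of `|Φ| ∈ 𝒯_i` (`η ≡ 1` on `ι(K)`), square-integrable by ★ F2a `lintegral_tsum_enorm_smoothed_sq_lt_top`. [cite: MoeglinWaldspurger1995, II.1.2] [cite: Folland1999, Thm. 2.37] -/
theorem lintegral_tsum_enorm_tauAverage_sq_lt_top [IsFiniteMeasure μK] [MeasurableInv Kc] [μK.IsInvInvariant] (hι : Measurable ι) (hτ : ∀ k, ‖τ k‖ = 1)
    {η : C_c(𝒢.Adelic, ℂ)} (hη : ∀ k : Kc, η (ι k) = 1) {Φ : 𝒢.Adelic → ℂ} (hΦm : Measurable Φ) (hΦ : ∀ (g : 𝒢.Adelic) (n : 𝔓.radical i), Φ (g * n) = Φ g)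
    (h2 : ∫⁻ x, (∑' q : 𝒢.quotientSubgroup ⧸ (𝔓.radical i).subgroupOf 𝒢.quotientSubgroup, ‖Φ ((Quotient.out x : 𝒢.Adelic) * ((q.out : 𝒢.quotientSubgroup) : 𝒢.Adelic))‖ₑ) ^ 2 ∂μ < ∞) :
    ∫⁻ x, (∑' q : 𝒢.quotientSubgroup ⧸ (𝔓.radical i).subgroupOf 𝒢.quotientSubgroup, ‖(fun h : 𝒢.Adelic => ∫ k, τ k * Φ (ι k * h) ∂μK) ((Quotient.out x : 𝒢.Adelic) * ((q.out : 𝒢.quotientSubgroup) : 𝒢.Adelic))‖ₑ) ^ 2 ∂μ < ∞ := by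
  set Φa : 𝒢.Adelic → ℂ := fun h => ((‖Φ h‖ : ℝ) : ℂ) with hΦa_def
  have hΦam : Measurable Φa := Complex.measurable_ofReal.comp hΦm.norm
  have hΦa : ∀ (g : 𝒢.Adelic) (n : 𝔓.radical i), Φa (g * n) = Φa g := fun g n => by simp only [hΦa_def, hΦ]
  have hea : ∀ h : 𝒢.Adelic, ‖Φa h‖ₑ = ‖Φ h‖ₑ := fun h => by
    rw [← ofReal_norm, ← ofReal_norm, hΦa_def, Complex.norm_real, norm_norm]
  have h2a : ∫⁻ x, (∑' q : 𝒢.quotientSubgroup ⧸ (𝔓.radical i).subgroupOf 𝒢.quotientSubgroup,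
      ‖Φa ((Quotient.out x : 𝒢.Adelic) * ((q.out : 𝒢.quotientSubgroup) : 𝒢.Adelic))‖ₑ) ^ 2 ∂μ < ∞ := by
    simpa only [hea] using h2
  have hF2a := lintegral_tsum_enorm_smoothed_sq_lt_top 𝒢 𝔓 i μ (μK.map ι) η hΦam hΦa h2a
  have hdom : ∀ h : 𝒢.Adelic, ‖(fun h : 𝒢.Adelic => ∫ k, τ k * Φ (ι k * h) ∂μK) h‖ₑ ≤ ‖(fun h : 𝒢.Adelic => ∫ g, η g * Φa (g⁻¹ * h) ∂(μK.map ι)) h‖ₑ := by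
    intro h
    have hI : (fun h : 𝒢.Adelic => ∫ g, η g * Φa (g⁻¹ * h) ∂(μK.map ι)) h = ((∫ k, ‖Φ ((ι k)⁻¹ * h)‖ ∂μK : ℝ) : ℂ) := by
      show ∫ g, η g * Φa (g⁻¹ * h) ∂(μK.map ι) = ((∫ k, ‖Φ ((ι k)⁻¹ * h)‖ ∂μK : ℝ) : ℂ)
      have hFm : AEStronglyMeasurable (fun g : 𝒢.Adelic => η g * Φa (g⁻¹ * h)) (μK.map ι) := (η.continuous.measurable.mul (hΦam.comp (measurable_inv.mul_const h))).aestronglyMeasurable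
      rw [integral_map hι.aemeasurable hFm, ← integral_complex_ofReal]
      exact integral_congr_ae (Eventually.of_forall fun k => by simp only [hΦa_def, hη k, one_mul])
    rw [← ofReal_norm, ← ofReal_norm, hI, Complex.norm_real, Real.norm_of_nonneg (integral_nonneg fun k => norm_nonneg _)]
    exact ENNReal.ofReal_le_ofReal (norm_tauAverage_le_integral_norm 𝒢 μK ι τ hτ Φ h)
  refine lt_of_le_of_lt (lintegral_mono fun x => pow_le_pow_left₀ bot_le (ENNReal.tsum_le_tsum fun q => hdom _) 2) hF2a

variable [μK.IsMulLeftInvariant] [μK.IsMulRightInvariant] [μK.IsInvInvariant]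

omit [μK.IsMulLeftInvariant] [μK.IsMulRightInvariant] in
/-- **`P_τ[θ_Φ] = [θ_{Φ^{♮,τ}}]`, `Φ^{♮,τ} ∈ 𝒯_i`**: the twisted `K`-average `∫_K τ(k)⁻¹ • R(ι k)[θ_Φ] dμK` (★ F1_τ) of the class of a square-integrable pseudo-Eisenstein series is the class of
`θ_{Φ^{♮,τ}}`, `Φ^{♮,τ}(h) = ∫_K τ(k) Φ(ι(k) h) dμK` Borel, right-`N_i(𝔸)`-invariant, square-summable (§1 representative, §3 pointwise road at a.e. `x`, §2–§3 membership).
[cite: MoeglinWaldspurger1995, II.1.1–II.1.3] [cite: DeitmarEchterhoff2014, Lemma 7.2.6] [cite: Knapp1986, VIII §3] -/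
theorem integral_smul_rightRegular_toLp_pseudoEisenstein_eq (hι : Continuous ι) (hτ : ∀ k, ‖τ k‖ = 1) (hτc : Continuous τ) {Φ : 𝒢.Adelic → ℂ} (hΦm : Measurable Φ)
    (hΦ : ∀ (g : 𝒢.Adelic) (n : 𝔓.radical i), Φ (g * n) = Φ g)
    (h2 : ∫⁻ x, (∑' q : 𝒢.quotientSubgroup ⧸ (𝔓.radical i).subgroupOf 𝒢.quotientSubgroup, ‖Φ ((Quotient.out x : 𝒢.Adelic) * ((q.out : 𝒢.quotientSubgroup) : 𝒢.Adelic))‖ₑ) ^ 2 ∂μ < ∞) :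
    ∃ (hm : Measurable fun h : 𝒢.Adelic => ∫ k, τ k * Φ (ι k * h) ∂μK)
      (hN : ∀ (h : 𝒢.Adelic) (n : 𝔓.radical i), (fun h : 𝒢.Adelic => ∫ k, τ k * Φ (ι k * h) ∂μK) (h * n) = (fun h : 𝒢.Adelic => ∫ k, τ k * Φ (ι k * h) ∂μK) h)
      (h2' : ∫⁻ x, (∑' q : 𝒢.quotientSubgroup ⧸ (𝔓.radical i).subgroupOf 𝒢.quotientSubgroup, ‖(fun h : 𝒢.Adelic => ∫ k, τ k * Φ (ι k * h) ∂μK) ((Quotient.out x : 𝒢.Adelic) * ((q.out : 𝒢.quotientSubgroup) : 𝒢.Adelic))‖ₑ) ^ 2 ∂μ < ∞),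
      ∫ k, (τ k)⁻¹ • 𝒢.rightRegular μ (ι k) ((memLp_two_pseudoEisenstein_automorphicQuotient 𝒢 𝔓 i μ hΦm hΦ h2).toLp _) ∂μK =
        (memLp_two_pseudoEisenstein_automorphicQuotient 𝒢 𝔓 i μ (Φ := fun h : 𝒢.Adelic => ∫ k, τ k * Φ (ι k * h) ∂μK) hm hN h2').toLp _ := by
  obtain ⟨η, hη⟩ := exists_compactlySupported_apply_eq_one (G := 𝒢.Adelic) hι
  have hτ0 : ∀ k, τ k ≠ 0 := ne_zero_of_norm_eq_one τ hτ
  have hm : Measurable fun h : 𝒢.Adelic => ∫ k, τ k * Φ (ι k * h) ∂μK := measurable_tauAverage 𝒢 μK ι τ hι.measurable hτc.measurable hΦm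
  have hN := tauAverage_mul_radical 𝒢 𝔓 i μK ι τ hΦ
  have h2' := lintegral_tsum_enorm_tauAverage_sq_lt_top 𝒢 𝔓 i μ μK ι τ hι.measurable hτ hη hΦm hΦ h2
  refine ⟨hm, hN, h2', Lp.ext ?_⟩
  have hw : Continuous fun k : Kc => (τ k)⁻¹ := hτc.inv₀ hτ0
  refine (coeFn_integral_smul_rightRegular_ae_eq 𝒢 μ μK hι hw (HasCompactSupport.of_compactSpace _) _).trans ?_
  refine (integral_mul_comp_congr_ae 𝒢 μ μK hι.measurable (MemLp.coeFn_toLp _) fun k : Kc => (τ k)⁻¹).trans ?_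
  refine Filter.EventuallyEq.trans ?_ (MemLp.coeFn_toLp _).symm
  filter_upwards [ae_tsum_lintegral_comp_lt_top 𝒢 𝔓 i μ μK ι hι.measurable hη hΦm hΦ h2] with x hx
  rw [integral_mul_tsum_eq_tsum 𝒢 𝔓 i μK ι τ hι.measurable hτc.measurable hτ hΦm hΦ hx]
  exact tsum_congr fun q => (tauAverage_eq_integral_inv 𝒢 μK ι τ Φ _).symm

/-! ## §4 The head: `Wᗮ ∩ L²(X)^{τ} = closure span {[θ_Ψ] : Ψ ∈ 𝒯_i, Ψ(ι(k)h) = τ(k)⁻¹ Ψ(h)}` whenever `Wᗮ = closure span {[θ_Φ] : Φ ∈ 𝒯_i}` -/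

omit [TopologicalSpace Kc] [IsTopologicalGroup Kc] [CompactSpace Kc] [SecondCountableTopology Kc] [MeasurableSpace Kc] [BorelSpace Kc] in
/-- **A `τ`-EQUIVARIANT `Ψ ∈ 𝒯_i` GIVES A `τ`-VECTOR `[θ_Ψ]`**: if `Ψ(ι(k) h) = τ(k)⁻¹ Ψ(h)` then `R(ι k)[θ_Ψ] = [θ_{Ψ(ι(k)⁻¹ ·)}] = [θ_{τ(k) Ψ}] = τ(k) • [θ_Ψ]`, i.e. `[θ_Ψ]` lies in
`⨅_k eigenspace(R(ι k), τ k)` (★ (H2)-d `rightRegular_inv_apply_toLp_pseudoEisenstein`). [cite: MoeglinWaldspurger1995, II.1.1] [cite: Knapp1986, VIII §3] -/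
theorem toLp_pseudoEisenstein_mem_iInf_eigenspace_of_forall (ι : Kc →* 𝒢.Adelic) (τ : Kc →* ℂ) {Φ : 𝒢.Adelic → ℂ} (hΦm : Measurable Φ)
    (hΦ : ∀ (g : 𝒢.Adelic) (n : 𝔓.radical i), Φ (g * n) = Φ g)
    (h2 : ∫⁻ x, (∑' q : 𝒢.quotientSubgroup ⧸ (𝔓.radical i).subgroupOf 𝒢.quotientSubgroup, ‖Φ ((Quotient.out x : 𝒢.Adelic) * ((q.out : 𝒢.quotientSubgroup) : 𝒢.Adelic))‖ₑ) ^ 2 ∂μ < ∞) (hK : ∀ (k : Kc) (h : 𝒢.Adelic), Φ (ι k * h) = (τ k)⁻¹ * Φ h) :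
    (memLp_two_pseudoEisenstein_automorphicQuotient 𝒢 𝔓 i μ hΦm hΦ h2).toLp _ ∈
      (⨅ k, Module.End.eigenspace ((𝒢.rightRegular μ (ι k) : 𝒢.L2 μ →L[ℂ] 𝒢.L2 μ) : 𝒢.L2 μ →ₗ[ℂ] 𝒢.L2 μ) (τ k)) := by
  refine (mem_iInf_eigenspace_iff (π := 𝒢.rightRegular μ) ι τ).2 fun k => ?_
  have hg : ι k = ((ι k)⁻¹)⁻¹ := (inv_inv _).symm
  have h2g : ∫⁻ x, (∑' q : 𝒢.quotientSubgroup ⧸ (𝔓.radical i).subgroupOf 𝒢.quotientSubgroup,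
      ‖(fun h => Φ ((ι k)⁻¹ * h)) ((Quotient.out x : 𝒢.Adelic) * ((q.out : 𝒢.quotientSubgroup) : 𝒢.Adelic))‖ₑ) ^ 2 ∂μ < ∞ := by
    rw [lintegral_tsum_enorm_translate_sq_eq 𝒢 𝔓 i μ hΦ (ι k)⁻¹]; exact h2
  rw [hg, rightRegular_inv_apply_toLp_pseudoEisenstein 𝒢 𝔓 i μ hΦm hΦ h2 (ι k)⁻¹ (hΦm.comp (measurable_const_mul _)) (translate_mul_radical 𝒢 𝔓 i hΦ _) h2g,
    ← MemLp.toLp_const_smul]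
  refine MemLp.toLp_congr _ _ (Eventually.of_forall fun x => ?_)
  have hk : ∀ h : 𝒢.Adelic, Φ ((ι k)⁻¹ * h) = τ k * Φ h := fun h => by
    rw [← map_inv, hK, map_inv, inv_inv]
  show (∑' q : 𝒢.quotientSubgroup ⧸ (𝔓.radical i).subgroupOf 𝒢.quotientSubgroup, Φ ((ι k)⁻¹ * ((Quotient.out x : 𝒢.Adelic) * ((q.out : 𝒢.quotientSubgroup) : 𝒢.Adelic)))) =
    τ k • ∑' q : 𝒢.quotientSubgroup ⧸ (𝔓.radical i).subgroupOf 𝒢.quotientSubgroup, Φ ((Quotient.out x : 𝒢.Adelic) * ((q.out : 𝒢.quotientSubgroup) : 𝒢.Adelic))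
  simp only [hk, smul_eq_mul]
  exact tsum_mul_left

include μK in
/-- **THE HEAD (generic)**: for a closed `R`-stable `W ≤ L²(X)` whose orthogonal complement is the closed span of the square-integrable pseudo-Eisenstein classes `Θ = {[θ_Φ] : i, Φ ∈ 𝒯_i}` (`hE`;
for `W = L²_cusp` this is ★ f1), a compact group `K → G(𝔸)` and a continuous unitary character `τ` of `K`: **`Wᗮ ⊓ L²(X)^{τ} = closure span Θ^{τ}`, `Θ^{τ} = {[θ_Ψ] : i, Ψ ∈ 𝒯_i,
Ψ(ι(k) h) = τ(k)⁻¹ Ψ(h)}`** — `⊆`: ★ F1_τ writes a `τ`-vector `v ∈ Wᗮ` as a limit of combinations of `P_τ[θ_Φ] = [θ_{Φ^{♮,τ}}]` (§3), `Φ^{♮,τ} ∈ 𝒯_i` `τ`-equivariant (§2); `⊇`: such `[θ_Ψ]`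
lie in `Wᗮ` and are `τ`-vectors (§4).  (Sets via the abbreviation hypotheses `hΘ hΘτ`: pass `rfl rfl`.) [cite: MoeglinWaldspurger1995, II.1.2–II.1.4] [cite: DeitmarEchterhoff2014, Lemma 7.2.6] [cite: Knapp1986, VIII §3] -/
theorem orthogonal_inf_iInf_eigenspace_eq_topologicalClosure_span (hι : Continuous ι) (hτ : ∀ k, ‖τ k‖ = 1) (hτc : Continuous τ) (W : ClosedSubrep (𝒢.rightRegular μ))
    {Θ Θτ : Set (𝒢.L2 μ)}
    (hΘ : Θ = {f : 𝒢.L2 μ | ∃ (i : 𝔓.ι) (Φ : 𝒢.Adelic → ℂ) (_ : Measurable Φ) (_ : ∀ (g : 𝒢.Adelic) (n : 𝔓.radical i), Φ (g * n) = Φ g)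
        (_ : ∫⁻ x, (∑' q : 𝒢.quotientSubgroup ⧸ (𝔓.radical i).subgroupOf 𝒢.quotientSubgroup, ‖Φ ((Quotient.out x : 𝒢.Adelic) * ((q.out : 𝒢.quotientSubgroup) : 𝒢.Adelic))‖ₑ) ^ 2 ∂μ < ∞)
        (hθ : MemLp (fun x : 𝒢.automorphicQuotient => ∑' q : 𝒢.quotientSubgroup ⧸ (𝔓.radical i).subgroupOf 𝒢.quotientSubgroup, Φ ((Quotient.out x : 𝒢.Adelic) * ((q.out : 𝒢.quotientSubgroup) : 𝒢.Adelic))) 2 μ), f = hθ.toLp _})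
    (hΘτ : Θτ = {f : 𝒢.L2 μ | ∃ (i : 𝔓.ι) (Φ : 𝒢.Adelic → ℂ) (_ : Measurable Φ) (_ : ∀ (g : 𝒢.Adelic) (n : 𝔓.radical i), Φ (g * n) = Φ g)
        (_ : ∫⁻ x, (∑' q : 𝒢.quotientSubgroup ⧸ (𝔓.radical i).subgroupOf 𝒢.quotientSubgroup, ‖Φ ((Quotient.out x : 𝒢.Adelic) * ((q.out : 𝒢.quotientSubgroup) : 𝒢.Adelic))‖ₑ) ^ 2 ∂μ < ∞)
        (_ : ∀ (k : Kc) (h : 𝒢.Adelic), Φ (ι k * h) = (τ k)⁻¹ * Φ h) (hθ : MemLp (fun x : 𝒢.automorphicQuotient => ∑' q : 𝒢.quotientSubgroup ⧸ (𝔓.radical i).subgroupOf 𝒢.quotientSubgroup,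
          Φ ((Quotient.out x : 𝒢.Adelic) * ((q.out : 𝒢.quotientSubgroup) : 𝒢.Adelic))) 2 μ), f = hθ.toLp _})
    (hE : (W.toSubmodule)ᗮ = (Submodule.span ℂ Θ).topologicalClosure) :
    (W.toSubmodule)ᗮ ⊓ (⨅ k, Module.End.eigenspace ((𝒢.rightRegular μ (ι k) : 𝒢.L2 μ →L[ℂ] 𝒢.L2 μ) : 𝒢.L2 μ →ₗ[ℂ] 𝒢.L2 μ) (τ k)) =
      (Submodule.span ℂ Θτ).topologicalClosure := by
  have hu := 𝒢.isUnitary_rightRegular μ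
  have hc : ((𝒢.rightRegular μ).restrict ι).IsStronglyContinuous := fun v => ((𝒢.isStronglyContinuous_rightRegular_holds μ) v).comp hι
  have hEW : (W.orthogonal hu).toSubmodule = (W.toSubmodule)ᗮ := ClosedSubrep.toSubmodule_orthogonal hu W
  have hSE : Θ ⊆ W.orthogonal hu := fun f hf => by
    show f ∈ (W.orthogonal hu).toSubmodule
    rw [hEW, hE]
    exact Submodule.le_topologicalClosure _ (Submodule.subset_span hf)
  have hES : (W.orthogonal hu).toSubmodule ≤ (Submodule.span ℂ Θ).topologicalClosure := by rw [hEW, hE]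
  have hF1 := inf_iInf_eigenspace_eq_topologicalClosure_span_image_tauAverage ι τ μK hu hc hτ hτc (W.orthogonal hu) hSE hES
  rw [hEW] at hF1
  have ha : ∀ f ∈ Θ, (∫ k, (τ k)⁻¹ • 𝒢.rightRegular μ (ι k) f ∂μK) ∈ Θτ := by
    intro f hf
    rw [hΘ] at hf
    obtain ⟨j, Φ, hΦm, hΦ, h2, hθ, rfl⟩ := hf
    obtain ⟨hm, hN, h2', heq⟩ := integral_smul_rightRegular_toLp_pseudoEisenstein_eq 𝒢 𝔓 j μ μK ι τ hι hτ hτc hΦm hΦ h2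
    rw [hΘτ]
    exact ⟨j, fun h : 𝒢.Adelic => ∫ k, τ k * Φ (ι k * h) ∂μK, hm, hN, h2', fun k h => tauAverage_mul_left 𝒢 μK ι τ hτ Φ k h,
      memLp_two_pseudoEisenstein_automorphicQuotient 𝒢 𝔓 j μ hm hN h2', heq⟩
  have hb : Θτ ⊆ ((W.toSubmodule)ᗮ ⊓ (⨅ k, Module.End.eigenspace ((𝒢.rightRegular μ (ι k) : 𝒢.L2 μ →L[ℂ] 𝒢.L2 μ) : 𝒢.L2 μ →ₗ[ℂ] 𝒢.L2 μ) (τ k)) :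
      Submodule ℂ (𝒢.L2 μ)) := by
    intro f hf
    rw [hΘτ] at hf
    obtain ⟨j, Φ, hΦm, hΦ, h2, hK, hθ, rfl⟩ := hf
    refine ⟨?_, toLp_pseudoEisenstein_mem_iInf_eigenspace_of_forall 𝒢 𝔓 j μ ι τ hΦm hΦ h2 hK⟩
    rw [← hEW]
    exact hSE (by rw [hΘ]; exact ⟨j, Φ, hΦm, hΦ, h2, hθ, rfl⟩)
  refine le_antisymm ?_ ?_
  · rw [hF1]
    refine Submodule.topologicalClosure_mono (Submodule.span_le.2 ?_)
    rintro _ ⟨f, hf, rfl⟩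
    exact Submodule.subset_span (ha f hf)
  · refine Submodule.topologicalClosure_minimal _ (Submodule.span_le.2 hb) ?_
    rw [hF1]
    exact Submodule.isClosed_topologicalClosure _

end Engine

/-! ## §5 The print for `U(Φ₂)` of a CM extension: `((L²_cusp)ᗮ)^{τ}` is the closed span of the `τ`-equivariant square-integrable pseudo-Eisenstein series -/

section CMTwo

variable (L : Type) [Field L] [NumberField L] [IsCMField L]
  [MeasurableSpace (cmDatum L 2 (Matrix.of fun i j : Fin 2 => if i.val + j.val + 1 = 2 then (1 : L) else 0)).Adelic]
  [BorelSpace (cmDatum L 2 (Matrix.of fun i j : Fin 2 => if i.val + j.val + 1 = 2 then (1 : L) else 0)).Adelic]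
  (μ : Measure (cmDatum L 2 (Matrix.of fun i j : Fin 2 => if i.val + j.val + 1 = 2 then (1 : L) else 0)).automorphicQuotient)
  [(cmDatum L 2 (Matrix.of fun i j : Fin 2 => if i.val + j.val + 1 = 2 then (1 : L) else 0)).IsAutomorphicMeasure μ]
  {Kc : Type*} [Group Kc] [TopologicalSpace Kc] [IsTopologicalGroup Kc] [CompactSpace Kc] [SecondCountableTopology Kc] [MeasurableSpace Kc] [BorelSpace Kc]
  (μK : Measure Kc) [IsProbabilityMeasure μK] [μK.IsMulLeftInvariant] [μK.IsMulRightInvariant] [μK.IsInvInvariant]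
  (ι : Kc →* (cmDatum L 2 (Matrix.of fun i j : Fin 2 => if i.val + j.val + 1 = 2 then (1 : L) else 0)).Adelic) (τ : Kc →* ℂ)

include μK in
/-- **`E^{τ} = ((L²_cusp(U(Φ₂)))ᗮ)^{τ} = closure span {[θ_Ψ] : i, Ψ ∈ 𝒯_i, Ψ(ι(k) h) = τ(k)⁻¹ Ψ(h)}`, LETTER-FREE** — for every automorphic `μ` on `X` (`U(Φ₂)` of the CM extension `L ∕ L⁺`,
in the tree's convention `X = G(𝔸) ⧸ G(K)`), every compact group `(Kc, μK)` with a continuous `ι : Kc →* U(Φ₂)(𝔸)` and every continuous unitary character `τ` of `Kc`: §4 over ★ f1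
`cmCuspidalSubspace_orthogonal_eq_topologicalClosure_span_two` — AMENDMENT #3 C.1 (the `τ`-generic ROADCARD C7 (a)): the `τ`-isotypic part of `(L²_cusp)ᗮ` is spanned by the `τ`-equivariant
square-integrable pseudo-Eisenstein series. [cite: MoeglinWaldspurger1995, II.1.2–II.1.4, II.1.12] [cite: DeitmarEchterhoff2014, Lemma 7.2.6] [cite: Knapp1986, VIII §3] -/
theorem cmCuspidalSubspace_orthogonal_inf_iInf_eigenspace_eq_topologicalClosure_span_two (hι : Continuous ι) (hτ : ∀ k, ‖τ k‖ = 1) (hτc : Continuous τ) :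
    ((cmCuspidalSubspace L 2 μ).toSubmodule)ᗮ ⊓ (⨅ k, Module.End.eigenspace (((cmDatum L 2 (Matrix.of fun i j : Fin 2 => if i.val + j.val + 1 = 2 then (1 : L) else 0)).rightRegular μ (ι k) :
        (cmDatum L 2 (Matrix.of fun i j : Fin 2 => if i.val + j.val + 1 = 2 then (1 : L) else 0)).L2 μ →L[ℂ] (cmDatum L 2 (Matrix.of fun i j : Fin 2 => if i.val + j.val + 1 = 2 then (1 : L) else 0)).L2 μ) :
        (cmDatum L 2 (Matrix.of fun i j : Fin 2 => if i.val + j.val + 1 = 2 then (1 : L) else 0)).L2 μ →ₗ[ℂ] (cmDatum L 2 (Matrix.of fun i j : Fin 2 => if i.val + j.val + 1 = 2 then (1 : L) else 0)).L2 μ) (τ k)) =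
      (Submodule.span ℂ {f : (cmDatum L 2 (Matrix.of fun i j : Fin 2 => if i.val + j.val + 1 = 2 then (1 : L) else 0)).L2 μ |
        ∃ (i : (cmParabolicData L 2).ι) (Φ : (cmDatum L 2 (Matrix.of fun i j : Fin 2 => if i.val + j.val + 1 = 2 then (1 : L) else 0)).Adelic → ℂ) (_ : Measurable Φ)
          (_ : ∀ (g : (cmDatum L 2 (Matrix.of fun i j : Fin 2 => if i.val + j.val + 1 = 2 then (1 : L) else 0)).Adelic) (n : (cmParabolicData L 2).radical i), Φ (g * n) = Φ g)
          (_ : ∫⁻ x, (∑' q : (cmDatum L 2 (Matrix.of fun i j : Fin 2 => if i.val + j.val + 1 = 2 then (1 : L) else 0)).quotientSubgroup ⧸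
              ((cmParabolicData L 2).radical i).subgroupOf (cmDatum L 2 (Matrix.of fun i j : Fin 2 => if i.val + j.val + 1 = 2 then (1 : L) else 0)).quotientSubgroup,
                ‖Φ ((Quotient.out x : (cmDatum L 2 (Matrix.of fun i j : Fin 2 => if i.val + j.val + 1 = 2 then (1 : L) else 0)).Adelic) *
                  (q.out : (cmDatum L 2 (Matrix.of fun i j : Fin 2 => if i.val + j.val + 1 = 2 then (1 : L) else 0)).Adelic))‖ₑ) ^ 2 ∂μ < ∞)
          (_ : ∀ (k : Kc) (h : (cmDatum L 2 (Matrix.of fun i j : Fin 2 => if i.val + j.val + 1 = 2 then (1 : L) else 0)).Adelic), Φ (ι k * h) = (τ k)⁻¹ * Φ h)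
          (hθ : MemLp (fun x : (cmDatum L 2 (Matrix.of fun i j : Fin 2 => if i.val + j.val + 1 = 2 then (1 : L) else 0)).automorphicQuotient =>
              ∑' q : (cmDatum L 2 (Matrix.of fun i j : Fin 2 => if i.val + j.val + 1 = 2 then (1 : L) else 0)).quotientSubgroup ⧸
                ((cmParabolicData L 2).radical i).subgroupOf (cmDatum L 2 (Matrix.of fun i j : Fin 2 => if i.val + j.val + 1 = 2 then (1 : L) else 0)).quotientSubgroup,
                  Φ ((Quotient.out x : (cmDatum L 2 (Matrix.of fun i j : Fin 2 => if i.val + j.val + 1 = 2 then (1 : L) else 0)).Adelic) *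
                    (q.out : (cmDatum L 2 (Matrix.of fun i j : Fin 2 => if i.val + j.val + 1 = 2 then (1 : L) else 0)).Adelic))) 2 μ), f = hθ.toLp _}).topologicalClosure := by
  haveI := discreteTopology_cmDatum_quotientSubgroup L 2 (Matrix.of fun i j : Fin 2 => if i.val + j.val + 1 = 2 then (1 : L) else 0)
  exact orthogonal_inf_iInf_eigenspace_eq_topologicalClosure_span (cmDatum L 2 (Matrix.of fun i j : Fin 2 => if i.val + j.val + 1 = 2 then (1 : L) else 0)) (cmParabolicData L 2) μ μK ι τ
    hι hτ hτc (cmCuspidalSubspace L 2 μ) rfl rfl (cmCuspidalSubspace_orthogonal_eq_topologicalClosure_span_two L μ)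

end CMTwo

end Summit.HodgeConjecture.HodgeConjecture.Cruxes.H413.K2E1PseudoEisensteinKTypeAverageU2

end
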